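import Literature.AlgebraicGeometry.Frobenioids.ArchimedeanCircleGeometry
import Literature.AlgebraicGeometry.Frobenioids.CircleOpensProofs6
import HarnessLib

/-!
# Frobenioids II, Lemma 3.2 (ii) on `O_ℂ^×`: conjugation-symmetric sub-arcs
# (abc-iut cell, layer L1; the Lemma 3.2 (ii) input of Prop. 3.4 (ii), condition (b))

Mochizuki, *The geometry of Frobenioids II: poly-Frobenioids*, Kyushu J. Math. **62** (2008)
401–460, §3, Lemma 3.2 (ii) p. 25 and Proposition 3.4 (ii) p. 30 ("it follows from [the latter
portion of] Lemma 3.2, (ii) …"). [cite: MochizukiFrdII2008, Lem 3.2 (ii) p.25]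

PROOF-ONLY file (nothing defined; seat abc-iut-L1-d3):
* `exists_inv_eq_smul_of_pow_eq_one` — Lemma 3.2 (ii), second sentence (tree:
  `CircleOpens.ItemII_roots_holds`, seat abc-iut-L1-t7), direction "⇐", transported from Mathlib's
  `Circle` to `normOneSubgroup ℂ` along `ArchFrd.exists_unitCircleEquiv` (complex conjugation on
  `S¹` is inversion): a connected open `A ∋ p` with `pⁿ = 1` contains a connected open `A'` with
  `A'⁻¹ = w · A'`, `wⁿ = 1`;
* `exists_inv_eq_smul_of_pow_eq` — the twisted form needed when the scalar of `φ₀` is not real: if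
  `p ∈ A` with `p^{2d} = v^{-2}` then some connected open `A' ⊆ A` has `A'⁻¹ = w · A'` with `w^d = v²`.
No side is taken on [IUTchIII] Cor. 3.12.
-/

namespace Literature.AlgebraicGeometry.Frobenioids

open Set
open scoped Pointwise

noncomputable section

namespace ArchFrd

/-- **Lemma 3.2 (ii)**, second sentence, direction "⇐", on `O_ℂ^× = normOneSubgroup ℂ` (complex
conjugation = inversion): if the connected open `A ⊆ S¹` contains `p` with `pⁿ = 1` (`n ≥ 1`), then
there is a connected open `A' ⊆ A` and `w` with `wⁿ = 1` and `A'⁻¹ = w · A'`. Transport of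
`CircleOpens.ItemII_roots_holds`. [cite: MochizukiFrdII2008, Lem 3.2 (ii) p.25] -/
theorem exists_inv_eq_smul_of_pow_eq_one {A : Set ↥(normOneSubgroup ℂ)} (hAc : IsConnected A)
    (hAo : IsOpen A) {n : ℕ} (hn : 0 < n) {p : ↥(normOneSubgroup ℂ)} (hp : p ∈ A) (hpn : p ^ n = 1) :
    ∃ A' : Set ↥(normOneSubgroup ℂ), IsConnected A' ∧ IsOpen A' ∧ A' ⊆ A ∧
      ∃ w : ↥(normOneSubgroup ℂ), w ^ n = 1 ∧ A'⁻¹ = w • A' := by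
  obtain ⟨e, h, heh, -⟩ := exists_unitCircleEquiv
  have hcont : Continuous e := h.continuous.congr heh
  have hpre : (e : Circle → ↥(normOneSubgroup ℂ)) ⁻¹' A = h.symm '' A := by
    rw [congrFun h.image_symm A]
    ext z
    show e z ∈ A ↔ h z ∈ A
    rw [heh]
  have hAc' : IsConnected ((e : Circle → ↥(normOneSubgroup ℂ)) ⁻¹' A) := by
    rw [hpre]
    exact hAc.image _ h.symm.continuous.continuousOn
  have hAo' : IsOpen ((e : Circle → ↥(normOneSubgroup ℂ)) ⁻¹' A) := by
    rw [hpre]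
    exact h.symm.isOpen_image.mpr hAo
  have hmem : (CircleOpens.phi n '' ((e : Circle → ↥(normOneSubgroup ℂ)) ⁻¹' A) ∩ {1, -1}).Nonempty := by
    refine ⟨CircleOpens.phi n (e.symm p), ⟨e.symm p, ?_, rfl⟩, ?_⟩
    · rw [mem_preimage, e.apply_symm_apply]
      exact hp
    · show (e.symm p) ^ (n : ℤ) ∈ ({1, -1} : Set Circle)
      rw [zpow_natCast, ← map_pow, hpn, map_one]
      exact mem_insert _ _
  obtain ⟨A'', hA''c, hA''o, hsub, w, hwn, hconj⟩ :=
    (CircleOpens.ItemII_roots_holds _ hAc' hAo' n hn).mpr hmem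
  have hphi : CircleOpens.phi (-1) = (fun z : Circle => z⁻¹) := funext CircleOpens.phi_neg_one
  rw [hphi, image_inv_eq_inv] at hconj
  refine ⟨e '' A'', hA''c.image _ hcont.continuousOn, ?_, ?_, e w, ?_, ?_⟩
  · have himg : (e : Circle → ↥(normOneSubgroup ℂ)) '' A'' = h '' A'' :=
      Set.ext fun x => ⟨fun ⟨z, hz, hzx⟩ => ⟨z, hz, (heh z).trans hzx⟩,
        fun ⟨z, hz, hzx⟩ => ⟨z, hz, (heh z).symm.trans hzx⟩⟩
    rw [himg]
    exact h.isOpen_image.mpr hA''o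
  · rintro _ ⟨z, hz, rfl⟩
    exact hsub hz
  · rw [← map_pow, hwn, map_one]
  · rw [← Set.image_inv, hconj, Set.image_smul_distrib]

/-- **Lemma 3.2 (ii)**, second sentence, in the TWISTED form used by Prop. 3.4 (ii) when the scalar of
`φ₀` is not real: if the connected open `A ⊆ S¹` contains `p` with `p^{2d} = v^{-2}` (`d ≥ 1`), then
there is a connected open `A' ⊆ A` and `w` with `w^d = v²` and `A'⁻¹ = w · A'` (apply the lemma to
`p⁻¹ · A ∋ 1` and translate back by `p`). [cite: MochizukiFrdII2008, Prop 3.4 (ii) p.30] -/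
theorem exists_inv_eq_smul_of_pow_eq {A : Set ↥(normOneSubgroup ℂ)} (hAc : IsConnected A)
    (hAo : IsOpen A) {d : ℕ} (hd : 0 < d) (v : ↥(normOneSubgroup ℂ)) {p : ↥(normOneSubgroup ℂ)}
    (hp : p ∈ A) (hpd : p ^ (2 * d) = (v ^ 2)⁻¹) :
    ∃ A' : Set ↥(normOneSubgroup ℂ), IsConnected A' ∧ IsOpen A' ∧ A' ⊆ A ∧
      ∃ w : ↥(normOneSubgroup ℂ), w ^ d = v ^ 2 ∧ A'⁻¹ = w • A' := by
  have h1 : (1 : ↥(normOneSubgroup ℂ)) ∈ p⁻¹ • A :=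
    mem_smul_set.mpr ⟨p, hp, by rw [smul_eq_mul, inv_mul_cancel]⟩
  obtain ⟨A'', hc, ho, hsub, w₀, hw₀, hconj⟩ :=
    exists_inv_eq_smul_of_pow_eq_one (isConnected_smul p⁻¹ hAc) (isOpen_smul p⁻¹ hAo) hd h1
      (one_pow d)
  refine ⟨p • A'', isConnected_smul p hc, isOpen_smul p ho, ?_, p⁻¹ ^ 2 * w₀, ?_, ?_⟩
  · rintro _ ⟨x, hx, rfl⟩
    have := hsub hx
    rwa [mem_smul_set_iff_inv_smul_mem, inv_inv] at this
  · rw [mul_pow, hw₀, mul_one, ← pow_mul, inv_pow, hpd, inv_inv]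
  · have key : ∀ y : ↥(normOneSubgroup ℂ), y ∈ A'' ↔ y⁻¹ ∈ w₀ • A'' := fun y => by
      rw [← hconj, Set.mem_inv, inv_inv]
    ext x
    rw [Set.mem_inv, mem_smul_set_iff_inv_smul_mem, smul_eq_mul, key,
      mem_smul_set_iff_inv_smul_mem, smul_eq_mul, mem_smul_set_iff_inv_smul_mem, smul_eq_mul,
      mem_smul_set_iff_inv_smul_mem, smul_eq_mul]
    have : w₀⁻¹ * (p⁻¹ * x⁻¹)⁻¹ = p⁻¹ * ((p⁻¹ ^ 2 * w₀)⁻¹ * x) := by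
      simp only [mul_inv_rev, inv_inv, sq]
      rw [mul_comm x p, ← mul_assoc, ← mul_assoc, ← mul_assoc, mul_comm p⁻¹ w₀⁻¹,
        mul_assoc w₀⁻¹ p⁻¹ (p * p), inv_mul_cancel_left]
    rw [this]

end ArchFrd

end

end Literature.AlgebraicGeometry.Frobenioids
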